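import Summits.QuantumFields.YangMills.Theorems.ContinuumLimitExists.Negative.OvercooledTriadicScheme
import Summits.QuantumFields.YangMills.Theorems.ComplexCouplingChannelContinuumLegGivenGapArraysChessboard
import Literature.MathematicalPhysics.QuantumFieldTheory.QCDTorusTranslation

/-!
# CB for the over-cooled triadic scheme: tightness of the ONE-BODY ∃-stub of line `birth` (v7 shape)

Crux `ContinuumLimitExists` (stmt-QuantumFields-16124), line `birth`, continuation lead c3, 2026-08-17.  Part II of the
tightness certificate for the reshaped constructive ∃-leg.  After c3 the UV clause of the ∃-stub is ONE-BODY: along a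
weak-coupling, polynomially growing scheme on (eventually) triadic tori, a `k`-uniform bound on the one-body array exponents
`arrayRoot r β_k a_k L_k m v z₀ q f ≤ C · max(ℓ,ℓ⁻¹)^p · cellNorm s ℓ f` (CB; `…ContinuumLimitExistsUvBoundsOfArrayExponent`,
p164124, gives `UUVB` from it by the landed chessboard and the Whitney step).  This file shows that CB — like `UUVB` before it
(`exists_degenerate_scheme_uuvb`, p155696) — does NOT force non-triviality: the over-cooled TRIADIC scheme of Part I
(`overcooledT r`, `…Negative.OvercooledTriadicScheme`, p165981) satisfies CB with `arrayRoot ≤ |f|₀` at every scale, while all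
its canonical curvature functions tend to `0` (`¬ND2 ∧ ¬ND3`).  Hence in the prospective v7 ∃-stub
`∃ r sch, weak ∧ PVG ∧ eventually-triadic ∧ CB ∧ Rot345 ∧ ND2 ∧ ND3` the floors `ND2 ∧ ND3` remain exactly the load-bearing
conjuncts (jointly with CB at the non-degenerate tuning).

Proof (`arrayRoot_overcooledT_le`): (i) `0 ≤ arrayMean` is the landed Fröhlich–Israel–Lieb–Simon chessboard estimate
`ContinuumLegGivenGap.arrays_chessboard` (p162501) with one cell; (ii) the array mean is a finite sum, over the
`((2L_k+1)⁴)^{#cells}` position assignments, of test-function weights times centred plaquette moments of length `#cells`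
(`abs_arrayMean_le`; positions outside the box of representatives are reduced modulo the torus by `centredMoment_congr_proj`,
from `configShift_torusLift`), and `#cells = numCells⁴ ≤ P_k` is inside the freezing budget of Part I, so
`arrayMean ≤ ((2L_k+1)⁴ |f|₀)^{#cells} ε_k ≤ |f|₀^{#cells}`; (iii) take the `#cells`-th root.  Then `cb_overcooledT` (CB verbatim,
`C = 1`, `p = s = k₀ = 0`) and the summary `exists_degenerate_triadic_scheme_cb`.  No definitions, no sorry; axioms standard.
-/

set_option autoImplicit false

noncomputable section

namespace Summit.QuantumFields.YangMills.Theorems.ContinuumLimitExists.Negative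

open scoped SchwartzMap
open Filter Topology MeasureTheory Finset
open Literature.MathematicalPhysics.QuantumFieldTheory Literature.MathematicalPhysics.QuantumLattice
open Literature.MathematicalPhysics.AQFT Literature.Probability.LatticeModels
open Summit.QuantumFields.YangMills.Cruxes.ContinuumLimitOnTrajectory.TwoOrbitSynchronisation
open Summit.QuantumFields.YangMills.Theorems.TunedSequenceExists.Negative.Freezing
open Summit.QuantumFields.YangMills.Theorems.ContinuumLegGivenGap.AlternatingArrays
open Summit.QuantumFields.YangMills.Theorems.ContinuumLegGivenGap (arrays_chessboard)

variable {G : Type} [Group G] [TopologicalSpace G] [IsTopologicalGroup G] [CompactSpace G]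
  [MeasurableSpace G] [BorelSpace G]

/-- Centred moments depend on the sites only through their classes on the torus: the periodic lift intertwines
`configShift` with the torus translation (`configShift_torusLift`). [folklore] -/
theorem centredMoment_congr_proj (r : LatticeRep G) (L : ℕ) (β : ℝ) (p : ℕ) (σ : Fin p → Option PlaqIdx)
    {x y : Fin p → Site 4} (h : ∀ i, Torus.proj (2 * L + 1) (x i) = Torus.proj (2 * L + 1) (y i)) :
    centredMoment r L β p σ x = centredMoment r L β p σ y := by
  unfold centredMoment
  refine integral_congr_ae (Eventually.of_forall fun U => ?_)
  refine Finset.prod_congr rfl fun i _ => ?_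
  have hx := configShift_torusLift (S := 2 * L + 1) (-(x i)) U
  have hy := configShift_torusLift (S := 2 * L + 1) (-(y i)) U
  have hneg : Torus.proj (2 * L + 1) (-(x i)) = Torus.proj (2 * L + 1) (-(y i)) := by
    funext j
    have := congrFun (h i) j
    simp only [Torus.proj_apply, Pi.neg_apply, Int.cast_neg] at this ⊢
    rw [this]
  simp only [hx, hy, hneg]

/-- A bound on centred moments at box positions extends to arbitrary positions (reduce each site to its box
representative modulo `2L+1`). [folklore] -/
theorem abs_centredMoment_le_of_box (r : LatticeRep G) (L : ℕ) (β : ℝ) (p : ℕ) (σ : Fin p → Option PlaqIdx) {ε : ℝ}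
    (h : ∀ x : Fin p → ↥(box 4 L), |centredMoment r L β p σ (fun i => (x i : Site 4))| ≤ ε)
    (y : Fin p → Site 4) : |centredMoment r L β p σ y| ≤ ε := by
  haveI : NeZero (2 * L + 1) := ⟨by omega⟩
  -- box representative of a site
  have hrep : ∀ s : Site 4, ∃ t : ↥(box 4 L), Torus.proj (2 * L + 1) (t : Site 4) = Torus.proj (2 * L + 1) s := by
    intro s
    refine ⟨⟨fun j => ((s j : ZMod (2 * L + 1))).valMinAbs, ?_⟩, ?_⟩
    · rw [mem_box]
      intro j
      have hle := ZMod.natAbs_valMinAbs_le (n := 2 * L + 1) ((s j : ZMod (2 * L + 1)))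
      have hL : (2 * L + 1) / 2 = L := by omega
      rw [hL] at hle
      have habs : |((s j : ZMod (2 * L + 1))).valMinAbs| ≤ (L : ℤ) := by
        rw [Int.abs_eq_natAbs]; exact_mod_cast hle
      exact abs_le.1 habs
    · funext j
      simp only [Torus.proj_apply, ZMod.coe_valMinAbs]
  choose t ht using hrep
  rw [← centredMoment_congr_proj r L β p σ (x := fun i => (t (y i) : Site 4)) (y := y) (fun i => ht (y i))]
  exact h fun i => t (y i)

/-- The array observable in the alphabet of `obsOf`: the letter `some q`. [folklore] -/
theorem arrayObs_eq_sum_obsOf (r : LatticeRep G) (βv a : ℝ) (L m : ℕ) (v z₀ z : Fin 4 → ℤ) (q : PlaqIdx)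
    (f : 𝓢(EuclideanSpace ℝ (Fin 4), ℝ)) (U : GaugeConfig 4 (2 * L + 1) G) :
    arrayObs r βv a L m v z₀ z q f U = ∑ x : ↥(box 4 L), f (a • siteToE (x : Site 4)) *
      ((obsOf r (some q)).F (configShift (-(cornerMap m v z₀ z q (x : Site 4))) (torusLift (2 * L + 1) U)) -
        wilsonTorusMean r.ρ βv L (obsOf r (some q)).F) := by
  unfold arrayObs
  rw [← Finset.sum_coe_sort]
  rfl

/-- **The array mean is small**: if every centred plaquette moment of length `#cells` (any positions) is at most `ε`, then
`|arrayMean| ≤ (∑_{x ∈ box} |f(a x)|)^{#cells} · ε`. [folklore] -/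
theorem abs_arrayMean_le (r : LatticeRep G) (βv a : ℝ) (L m : ℕ) (v z₀ : Fin 4 → ℤ) (q : PlaqIdx)
    (f : 𝓢(EuclideanSpace ℝ (Fin 4), ℝ)) {ε : ℝ}
    (hmom : ∀ (σ : Fin (Fintype.card ↥(cellIndices L m)) → Option PlaqIdx)
      (y : Fin (Fintype.card ↥(cellIndices L m)) → Site 4),
      |centredMoment r L βv (Fintype.card ↥(cellIndices L m)) σ y| ≤ ε) :
    |arrayMean r βv a L m v z₀ q f| ≤
      (∑ x : ↥(box 4 L), |f (a • siteToE (x : Site 4))|) ^ Fintype.card ↥(cellIndices L m) * ε := by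
  classical
  haveI : SecondCountableTopology G := secondCountable_of_latticeRep r
  haveI : IsProbabilityMeasure (wilsonMeasure (d := 4) (L := 2 * L + 1) (G := G) r.ρ βv) :=
    isProbabilityMeasure_wilsonMeasure r.ρ r.continuous _
  set ι := ↥(cellIndices L m) with hι
  set n := Fintype.card ι with hn
  -- the field factor of cell `i` at box position `x`
  set Gf : ι → ↥(box 4 L) → GaugeConfig 4 (2 * L + 1) G → ℝ := fun i x U =>
    (obsOf r (some q)).F (configShift (-(cornerMap m v z₀ (i : Fin 4 → ℤ) q (x : Site 4))) (torusLift (2 * L + 1) U)) -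
      wilsonTorusMean r.ρ βv L (obsOf r (some q)).F with hGf
  set c : ↥(box 4 L) → ℝ := fun x => f (a • siteToE (x : Site 4)) with hc
  have hcont : ∀ (i : ι) (x : ↥(box 4 L)), Continuous fun U => Gf i x U := fun i x =>
    (continuous_obsOf_shift_lift r (some q) _ _).sub continuous_const
  -- Step 1: the integrand as a sum over position assignments
  have hexp : ∀ U : GaugeConfig 4 (2 * L + 1) G,
      ∏ z ∈ cellIndices L m, arrayObs r βv a L m v z₀ z q f U =
        ∑ φ : ι → ↥(box 4 L), (∏ i, c (φ i)) * ∏ i, Gf i (φ i) U := by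
    intro U
    rw [← Finset.prod_coe_sort]
    have h1 : ∀ i : ι, arrayObs r βv a L m v z₀ (i : Fin 4 → ℤ) q f U = ∑ x : ↥(box 4 L), c x * Gf i x U :=
      fun i => arrayObs_eq_sum_obsOf r βv a L m v z₀ (i : Fin 4 → ℤ) q f U
    simp_rw [h1]
    rw [Finset.prod_univ_sum]
    simp only [Fintype.piFinset_univ]
    refine Finset.sum_congr rfl fun φ _ => ?_
    rw [Finset.prod_mul_distrib]
  -- Step 2: each term's integral is a coefficient times a centred moment of length `n`
  have hterm : ∀ φ : ι → ↥(box 4 L),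
      |∫ U, (∏ i, c (φ i)) * ∏ i, Gf i (φ i) U ∂(wilsonMeasure (d := 4) (L := 2 * L + 1) r.ρ βv)| ≤
        (∏ i, |c (φ i)|) * ε := by
    intro φ
    rw [integral_const_mul, abs_mul, Finset.abs_prod]
    refine mul_le_mul_of_nonneg_left ?_ (Finset.prod_nonneg fun i _ => abs_nonneg _)
    -- reindex the cells by `Fin n`
    set e : ι ≃ Fin n := Fintype.equivFin ι with he
    have hre : ∀ U, ∏ i, Gf i (φ i) U = ∏ j : Fin n, Gf (e.symm j) (φ (e.symm j)) U :=
      fun U => (Equiv.prod_comp e.symm (fun i => Gf i (φ i) U)).symm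
    simp_rw [hre]
    exact hmom (fun _ => some q) (fun j => cornerMap m v z₀ (e.symm j : Fin 4 → ℤ) q (φ (e.symm j) : Site 4))
  -- Step 3: assemble
  unfold arrayMean
  simp_rw [hexp]
  rw [integral_finsetSum _ fun φ _ =>
    ((integrable_of_continuous _ (continuous_finsetProd _ fun i _ => hcont i (φ i))).const_mul _)]
  refine (Finset.abs_sum_le_sum_abs _ _).trans ?_
  refine (Finset.sum_le_sum fun φ _ => hterm φ).trans ?_
  rw [← Finset.sum_mul]
  have hcount : ∑ φ : ι → ↥(box 4 L), ∏ i, |c (φ i)| = (∑ x : ↥(box 4 L), |c x|) ^ n := by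
    have h := Finset.prod_univ_sum (fun _ : ι => (Finset.univ : Finset ↥(box 4 L))) (fun _ x => |c x|)
    rw [Fintype.piFinset_univ] at h
    rw [← h, Finset.prod_const, Finset.card_univ]
  rw [hcount]

/-- The cell index set of level `m` has `numCells⁴` elements. [folklore] -/
theorem card_cellIndices (L m : ℕ) : Fintype.card ↥(cellIndices L m) = numCells L m ^ 4 := by
  rw [Fintype.card_coe]
  unfold cellIndices
  rw [Fintype.card_piFinset, Finset.prod_const, Finset.card_univ, Fintype.card_fin,
    Finset.card_image_of_injective _ Nat.cast_injective, Finset.card_range]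

/-- The cell count of every level is within the moment-length budget: `numCells⁴ ≤ P_k`. [folklore] -/
theorem numCells_pow_le_otP (k m : ℕ) : numCells (otL k) m ^ 4 ≤ otP k :=
  Nat.pow_le_pow_left (Nat.div_le_self _ _) 4

/-- Sup-norm bound for the test-function weights over the box: `∑_{x ∈ box} |f(a x)| ≤ (2L+1)⁴ · |f|₀`. [folklore] -/
theorem sum_abs_apply_le (f : 𝓢(EuclideanSpace ℝ (Fin 4), ℝ)) (a : ℝ) (L : ℕ) :
    ∑ x : ↥(box 4 L), |f (a • siteToE (x : Site 4))| ≤ (2 * (L : ℝ) + 1) ^ 4 * SchwartzMap.seminorm ℝ 0 0 f := by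
  have hterm : ∀ x ∈ (Finset.univ : Finset ↥(box 4 L)),
      |f (a • siteToE (x : Site 4))| ≤ SchwartzMap.seminorm ℝ 0 0 f := fun x _ => by
    rw [← Real.norm_eq_abs]
    exact SchwartzMap.norm_le_seminorm ℝ f _
  refine (Finset.sum_le_sum hterm).trans ?_
  rw [Finset.sum_const, nsmul_eq_mul, Finset.card_univ, Fintype.card_coe, card_box]
  push_cast
  rfl

/-- **The one-body array exponents of the over-cooled triadic scheme are bounded by the sup norm of the test function** —
at EVERY level `k`, for every admissible cell level `m`, offset, home cell in the half-box, orientation and core-supported `f`: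
`arrayRoot ≤ |f|₀`.  Nonnegativity of the array mean is the landed chessboard estimate (`arrays_chessboard`); smallness
`arrayMean ≤ |f|₀^{#cells}` is the frozen-moment bound of length `#cells ≤ P_k` against the `((2L_k+1)⁴)^{#cells}` position
assignments; then take the `#cells`-th root. [folklore] -/
theorem arrayRoot_overcooledT_le (r : LatticeRep G) (k m : ℕ) (v z₀ : Fin 4 → ℤ) (q : PlaqIdx)
    (f : 𝓢(EuclideanSpace ℝ (Fin 4), ℝ)) (hm : LevelAdmissible (otL k) m) (hbox : CellInHalfBox (otL k) m v z₀)
    (hf : tsupport f ⊆ physCore (((k : ℝ) + 1)⁻¹) m v z₀) :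
    arrayRoot r (otBeta r k) (((k : ℝ) + 1)⁻¹) (otL k) m v z₀ q f ≤ SchwartzMap.seminorm ℝ 0 0 f := by
  -- nonnegativity of the array mean: the chessboard estimate (one cell)
  have hnn : 0 ≤ arrayMean r (otBeta r k) (((k : ℝ) + 1)⁻¹) (otL k) m v z₀ q f := by
    have h := (arrays_chessboard G r (overcooledT r) k m (overcooledT_β_nonneg r k) hm v 1 (fun _ => q)
      (fun _ => z₀) (fun _ => f) (SchwartzMap.tensorFin 1 fun _ => ofRealTest f) (fun _ => hbox)
      (Function.injective_of_subsingleton _) (fun _ => hf) (isTensorOf_tensorFin _)).1 0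
    simpa using h
  -- the length of the array and the budget
  set n := Fintype.card ↥(cellIndices (otL k) m) with hn_def
  have hn : n = numCells (otL k) m ^ 4 := card_cellIndices _ _
  have hnP : n ≤ otP k := hn ▸ numCells_pow_le_otP k m
  have hn1 : 1 ≤ n := by
    obtain ⟨w, hw, hw0⟩ := numCells_eq_two_mul hm
    rw [hn, hw]
    exact Nat.one_le_pow _ _ (by omega)
  -- every centred moment of length `n` is at most `ε_k`
  have hmom : ∀ (σ : Fin n → Option PlaqIdx) (y : Fin n → Site 4),
      |centredMoment r (otL k) (otBeta r k) n σ y| ≤ otEps k := fun σ y =>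
    abs_centredMoment_le_of_box r (otL k) (otBeta r k) n σ (fun x => otBeta_spec r hnP hn1 σ x) y
  have hmean := abs_arrayMean_le r (otBeta r k) (((k : ℝ) + 1)⁻¹) (otL k) m v z₀ q f hmom
  set M : ℝ := SchwartzMap.seminorm ℝ 0 0 f with hM_def
  have hM : 0 ≤ M := apply_nonneg _ _
  set S : ℝ := (2 * (otL k : ℝ) + 1) ^ 4 with hS_def
  have hS1 : 1 ≤ S := one_le_pow₀ (by
    have h0 : (0 : ℝ) ≤ 2 * (otL k : ℝ) := by positivity
    linarith)
  have hsum : ∑ x : ↥(box 4 (otL k)), |f (((k : ℝ) + 1)⁻¹ • siteToE (x : Site 4))| ≤ S * M :=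
    sum_abs_apply_le f _ _
  -- smallness: `arrayMean ≤ M ^ n`
  have hle : arrayMean r (otBeta r k) (((k : ℝ) + 1)⁻¹) (otL k) m v z₀ q f ≤ M ^ n := by
    refine ((le_abs_self _).trans hmean).trans ?_
    have hs0 : 0 ≤ ∑ x : ↥(box 4 (otL k)), |f (((k : ℝ) + 1)⁻¹ • siteToE (x : Site 4))| :=
      Finset.sum_nonneg fun x _ => abs_nonneg _
    calc (∑ x : ↥(box 4 (otL k)), |f (((k : ℝ) + 1)⁻¹ • siteToE (x : Site 4))|) ^ n * otEps k
        ≤ (S * M) ^ n * otEps k :=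
          mul_le_mul_of_nonneg_right (pow_le_pow_left₀ hs0 hsum n) (otEps_pos k).le
      _ = M ^ n * (S ^ n * otEps k) := by rw [mul_pow]; ring
      _ ≤ M ^ n * 1 := by
          refine mul_le_mul_of_nonneg_left ?_ (pow_nonneg hM n)
          have hpos : (0 : ℝ) < ((k : ℝ) + 1) * S ^ otP k := by positivity
          rw [hS_def] at hS1 ⊢
          unfold otEps
          rw [mul_inv_le_iff₀ hpos, one_mul]
          calc ((2 * (otL k : ℝ) + 1) ^ 4) ^ n ≤ ((2 * (otL k : ℝ) + 1) ^ 4) ^ otP k :=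
                pow_le_pow_right₀ hS1 hnP
            _ ≤ ((k : ℝ) + 1) * ((2 * (otL k : ℝ) + 1) ^ 4) ^ otP k :=
                le_mul_of_one_le_left (by positivity) (by
                  have : (0 : ℝ) ≤ k := Nat.cast_nonneg k
                  linarith)
      _ = M ^ n := mul_one _
  -- take the `n`-th root
  unfold arrayRoot
  have hexp : (1 : ℝ) / (numCells (otL k) m : ℝ) ^ 4 = ((n : ℝ))⁻¹ := by
    rw [hn, one_div]; push_cast; rfl
  rw [hexp]
  calc arrayMean r (otBeta r k) (((k : ℝ) + 1)⁻¹) (otL k) m v z₀ q f ^ ((n : ℝ)⁻¹)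
      ≤ (M ^ n) ^ ((n : ℝ)⁻¹) := Real.rpow_le_rpow hnn hle (by positivity)
    _ = M := Real.pow_rpow_inv_natCast hM (by omega)

/-- **CB holds for the over-cooled triadic scheme** (with `C = 1`, `p = 0`, `s = 0`, threshold `0`): the one-body
array-exponent bound of the prospective v7 ∃-stub of line `birth`, verbatim. [folklore] -/
theorem cb_overcooledT (r : LatticeRep G) :
    ∃ (C : ℝ) (p s k₀ : ℕ), 0 ≤ C ∧
      ∀ k : ℕ, k₀ ≤ k → ∀ (m : ℕ) (v z₀ : Fin 4 → ℤ) (q : PlaqIdx)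
        (f : SchwartzMap (EuclideanSpace ℝ (Fin 4)) ℝ),
        LevelAdmissible ((overcooledT r).L k) m → CellInHalfBox ((overcooledT r).L k) m v z₀ →
        tsupport f ⊆ physCore ((overcooledT r).a k) m v z₀ →
        arrayRoot r ((overcooledT r).β k) ((overcooledT r).a k) ((overcooledT r).L k) m v z₀ q f ≤
          C * max ((overcooledT r).a k * cellSide m) ((overcooledT r).a k * cellSide m)⁻¹ ^ p *
            cellNorm s ((overcooledT r).a k * cellSide m) f := by
  refine ⟨1, 0, 0, 0, zero_le_one, fun k _ m v z₀ q f hm hbox hf => ?_⟩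
  have h := arrayRoot_overcooledT_le r k m v z₀ q f hm hbox hf
  simpa [cellNorm] using h

/-- **Tightness of the one-body ∃-stub (v7 shape) — the non-degeneracy clauses stay load-bearing.** For every compact `G`
admitting a faithful unitary lattice representation there is a weak-coupling, polynomially growing scheme on (eventually)
TRIADIC tori whose one-body array exponents obey the canonical-scaling bound CB (indeed `arrayRoot ≤ |f|₀` at every scale),
with `ConvProducts`, `Rot345`, `CoreClustering` — and which violates `ND2` and `ND3`.  So in
`∃ r sch, weak ∧ PVG ∧ eventually-triadic ∧ CB ∧ Rot345 ∧ ND2 ∧ ND3` the floors `ND2 ∧ ND3` are exactly what separates the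
physical theory from total degeneration (as in the `UUVB` form, `exists_degenerate_scheme_uuvb`, p155696). [folklore] -/
theorem exists_degenerate_triadic_scheme_cb (r : LatticeRep G) :
    ∃ sch : SpeciesScheme (YMSpecies G),
      sch.HasWeakCouplingLimit ∧ PolyVolumeGrowth sch ∧ (∀ᶠ k in atTop, IsTriadic (sch.L k)) ∧
      (∃ (C : ℝ) (p s k₀ : ℕ), 0 ≤ C ∧
        ∀ k : ℕ, k₀ ≤ k → ∀ (m : ℕ) (v z₀ : Fin 4 → ℤ) (q : PlaqIdx)
          (f : SchwartzMap (EuclideanSpace ℝ (Fin 4)) ℝ),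
          LevelAdmissible (sch.L k) m → CellInHalfBox (sch.L k) m v z₀ →
          tsupport f ⊆ physCore (sch.a k) m v z₀ →
          arrayRoot r (sch.β k) (sch.a k) (sch.L k) m v z₀ q f ≤
            C * max (sch.a k * cellSide m) (sch.a k * cellSide m)⁻¹ ^ p *
              cellNorm s (sch.a k * cellSide m) f) ∧
      ConvProducts r sch ∧ Rot345 r sch ∧ CoreClustering r sch ∧ ¬ ND2 r sch ∧ ¬ ND3 r sch :=
  ⟨overcooledT r, hasWeakCouplingLimit_overcooledT r, polyVolumeGrowth_overcooledT r,
    Eventually.of_forall (isTriadic_overcooledT r), cb_overcooledT r, convProducts_overcooledT r,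
    rot345_overcooledT r, coreClustering_overcooledT r, not_ND2_overcooledT r, not_ND3_overcooledT r⟩


end Summit.QuantumFields.YangMills.Theorems.ContinuumLimitExists.Negative

end
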